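import Literature.NumberTheory.EllipticCurves.HeegnerPointsOfConductor
import Literature.NumberTheory.EllipticCurves.EichlerIntegralHeckeProofs
import HarnessLib

/-!
# Hecke neighbours of a Heegner form raise the conductor by `ℓ`

Team x11b3 (N8/O2), `h37` PIECE 1 = clause (β2-b)(i) of the `h37` scope memo (x11b3-p7,
`H37-SCOPE.md`; lead GEN 8 deal R9-9).  Summit-side THEOREM-ONLY file (no definition, no named
fact, no `sorry`), `p`-free.  HONEST FRAMING (H47): plumbing toward Gross 1991, Prop. 3.7 (1)
(`Tr_ℓ y_n = a_ℓ · y_m`, via "`Tr_ℓ x_n = T_ℓ(x_m)` as divisors on `X₀(N)`" [Gross 1991, §3,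
p. 217]) only; it discharges neither `h37` nor `h44` nor any class-record hypothesis; the
labelled set of the `h44` programme stays `{h37}`; nothing is `p = 3`-specific; nothing is booked;
no mark / label / count moves.

## What is proved (tree vocabulary: `heegnerForms`, `heegnerTau`, `heegnerFormOfConductor`,
## `tpB`, `tpD`, `ModularParametrizationData.φ`)

Let `Q = (A, B, C)` be a Heegner form of level `N` and discriminant `D = B² − 4AC < 0`
(`Q ∈ heegnerForms N D`: `A > 0`, `N ∣ A`, `gcd(A, B, C) = 1`) and let `ℓ` be a prime which is
INERT for `D` in the elementary sense `∀ x, 4ℓ ∤ x² − D` (for `D ≡ 0, 1 (mod 4)` this says: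
`D` is a non-residue mod `ℓ` if `ℓ` is odd, `D ≡ 5 (mod 8)` if `ℓ = 2`; `ℓ = 2` is allowed — at
`p = 3` the prime `2` can be a Kolyvagin prime).  The `ℓ + 1` Hecke neighbours of `τ_Q`,
`(τ_Q + j)/ℓ = tpB ℓ j • τ_Q` (`j mod ℓ`) and `ℓ τ_Q = tpD ℓ • τ_Q`, are the Heegner points of the
explicit forms

  `Q_j = (A ℓ², ℓ (B − 2Aj), A j² − B j + C)`,   `Q_∞ = (A, ℓ B, ℓ² C)`:

* `translate_mem_heegnerForms`, `scale_mem_heegnerForms` — `Q_j, Q_∞ ∈ heegnerForms N (ℓ² D)`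
  (discriminant `ℓ² D`, `A_j > 0`, `N ∣ A_j`, PRIMITIVE: a common prime divisor `q ≠ ℓ` would
  divide `A, B, C`; `q = ℓ` would give `ℓ ∣ C_j`, i.e. `4ℓ ∣ (B − 2Aj)² − D = 4A C_j`, resp.
  `ℓ ∣ A`, i.e. `4ℓ ∣ B² − D = 4AC` — excluded by inertness: `not_dvd_third_of_inert`,
  `not_dvd_fst_of_inert`), with `B_j ≡ ℓ B (mod 2N)` (`translate_snd_modEq`);
* `heegnerTau_translate`, `heegnerTau_scale` (+ `coe_` forms) — `τ_{Q_j} = tpB ℓ j • τ_Q`,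
  `τ_{Q_∞} = tpD ℓ • τ_Q` (the point `(τ_Q + j)/ℓ`, resp. `ℓ τ_Q`, is a root of `Q_j`, resp. `Q_∞`,
  and `eq_heegnerTau_of_isRoot`);
* `heegnerFormOfConductor_mul`, `heegnerPointOfConductor_mul` — for Gross's form of conductor `m`,
  `Q = heegnerFormOfConductor D β m = (m²(β² − D)/4, mβ, 1)`, the neighbour `Q_0` IS
  `heegnerFormOfConductor D β (mℓ)`, so `x(mℓ) = tpB ℓ 0 • x(m) = x(m)/ℓ` (the tree's
  `coe_heegnerPointOfConductor_eq_div` in `T_ℓ`-form);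
* `lFunction_smul_φ_heegnerTau`, `lFunction_smul_heegnerPointComplexOfConductor` — with the
  tree's Hecke equivariance `ModularParametrizationData.lFunction_zsmul_φ_of_not_dvd`
  (`a_ℓ(W) • φ(τ) = Σ_{j mod ℓ} φ((τ + j)/ℓ) + φ(ℓτ)`, `ℓ ∤ N`):
  `a_ℓ(W) • φ(τ_Q) = Σ_{j mod ℓ} φ(τ_{Q_j}) + φ(τ_{Q_∞})` in `E(ℂ)`, in particular for
  `y(m) = φ(x(m))` with the `j = 0` term equal to `y(mℓ)` (`heegnerPointComplexOfConductor_mul`).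

What is NOT here: the `ℓ + 1` classes are pairwise `Γ₀(N)`-inequivalent when `D < −4`
(part (c), companion file `X11b/HeegnerHeckeNeighboursInequivalent.lean`); the inertness
hypothesis `∀ x, 4ℓ ∤ x² − m² d_K` follows from the tree's Kolyvagin-prime clause
`(Ideal.span {(ℓ : 𝓞 K)}).IsPrime`, `ℓ ∤ m` (bridge file `X11b/HeegnerHeckeInert.lean`); and —
the next piece of (β2-b), size L — the classes form ONE orbit under `Gal(K[mℓ]/K[m])` (Shimura
reciprocity at conductor `mℓ`).

## References

* B. H. Gross, *Kolyvagin's work on modular elliptic curves*, in *L-functions and Arithmetic*,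
  LMS LNS 153 (1991), §3, Prop. 3.7 and its proof (held `book:editornd-l-functions-arithmetic`,
  p. 217 L19–26). [GrossLMS1991]
* B. H. Gross, *Heegner points on X₀(N)* (1984), §6 (the Hecke action on Heegner points; Gross's
  "[G; §6]"). [Gross1984]
* F. Diamond, J. Shurman, *A First Course in Modular Forms*, GTM 228 (2005), (5.2) (the coset
  representatives `β_j = (1 j; 0 p)`, `0 ≤ j < p`, and, for `p ∤ N`, `β_∞ = (m n; N p)(p 0; 0 1)`
  with `mp − nN = 1`, i.e. `β_∞ ≡ (p 0; 0 1) = tpD p` modulo left multiplication by `Γ₀(N)` —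
  the same point of `Γ₀(N)\ℍ`). [DiamondShurman2005]

## Mathlib / tree search

Tree: `heegnerForms`, `heegnerTau`, `heegnerTau_isRoot`, `eq_heegnerTau_of_isRoot`
(`HeegnerPoints`, `HeegnerPointsClassesProofs`), `heegnerFormOfConductor`,
`heegnerPointOfConductor`, `heegnerPointComplexOfConductor` (`HeegnerPointsOfConductor`), `tpB`,
`tpD`, `coe_tpB_smul`, `coe_tpD_smul` (`HeckeOperatorsProofs`),
`ModularParametrizationData.lFunction_zsmul_φ_of_not_dvd` (`EichlerIntegralHeckeProofs`); the
special cases `ℓ = 2, 3` of `heegnerTau_translate` are the tree's `divPoint_two_heegnerTau`,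
`divPoint_three_heegnerTau` (`SingularModuliWeber*Inert`).  Mathlib: `Int.exists_prime_and_dvd`,
`Int.prime_iff_natAbs_prime`, `Int.isUnit_iff_natAbs_eq`.  INTENT-grep `heckeNeighbour|
HeegnerHecke|translate_mem_heegnerForms` over INBOX / `lean search`: no other owner.
-/

open UpperHalfPlane
open scoped MatrixGroups

namespace Summit.BirchSwinnertonDyer.Rank1Residual.X11b.HeegnerHecke

open Literature.NumberTheory.EllipticCurves
open Literature.NumberTheory.EllipticCurves.ModularForms

variable {N : ℕ} {D A B C : ℤ} {ℓ : ℕ}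

/-! ### Inertness of `ℓ` for `D`, in the elementary form `∀ x, 4ℓ ∤ x² − D` -/

/-- For `ℓ` inert for `D = B² − 4AC` (`4ℓ ∤ x² − D` for all `x`), `ℓ` does not divide the third
coefficient `C_j = A j² − B j + C` of any translate: `(B − 2Aj)² − D = 4A C_j`. [folklore] -/
theorem not_dvd_third_of_inert (hdisc : B ^ 2 - 4 * A * C = D)
    (hin : ∀ x : ℤ, ¬ (4 * (ℓ : ℤ) ∣ x ^ 2 - D)) (j : ℤ) :
    ¬ ((ℓ : ℤ) ∣ A * j ^ 2 - B * j + C) := by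
  rintro ⟨c, hc⟩
  refine hin (B - 2 * A * j) ⟨A * c, ?_⟩
  linear_combination hdisc + 4 * A * hc

/-- For `ℓ` inert for `D = B² − 4AC`, `ℓ ∤ A`: `B² − D = 4AC`. [folklore] -/
theorem not_dvd_fst_of_inert (hdisc : B ^ 2 - 4 * A * C = D)
    (hin : ∀ x : ℤ, ¬ (4 * (ℓ : ℤ) ∣ x ^ 2 - D)) : ¬ ((ℓ : ℤ) ∣ A) := by
  rintro ⟨c, hc⟩
  refine hin B ⟨c * C, ?_⟩
  linear_combination hdisc + 4 * C * hc

/-- A prime integer `q` dividing the prime number `ℓ` is `±ℓ`: whatever `q` divides, `ℓ`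
divides. [folklore] -/
theorem natCast_dvd_of_prime_dvd (hℓ : ℓ.Prime) {q : ℤ} (hq : Prime q) (hqℓ : q ∣ (ℓ : ℤ))
    {x : ℤ} (hx : q ∣ x) : (ℓ : ℤ) ∣ x := by
  have h1 : q.natAbs ∣ ℓ := by
    have h := Int.natAbs_dvd_natAbs.mpr hqℓ
    rwa [Int.natAbs_natCast] at h
  have h2 : q.natAbs = ℓ :=
    (Nat.prime_dvd_prime_iff_eq (Int.prime_iff_natAbs_prime.mp hq) hℓ).mp h1
  rw [← h2]
  exact Int.natAbs_dvd.mpr hx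

/-! ### The `ℓ + 1` neighbour forms are Heegner forms of discriminant `ℓ² D` -/

/-- Primitivity of the translate `Q_j = (A ℓ², ℓ(B − 2Aj), A j² − B j + C)` of a primitive form
`(A, B, C)` at a prime `ℓ ∤ C_j`: a common prime divisor `q` is `≠ ±ℓ` (else `ℓ ∣ C_j`), so
`q ∣ A`, `q ∣ B − 2Aj`, `q ∣ C_j`, whence `q ∣ A, B, C`. [folklore] -/
theorem isUnit_of_dvd_translate (hprim : ∀ d : ℤ, d ∣ A → d ∣ B → d ∣ C → IsUnit d)
    (hℓ : ℓ.Prime) {j : ℤ} (hC : ¬ ((ℓ : ℤ) ∣ A * j ^ 2 - B * j + C)) {d : ℤ}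
    (h1 : d ∣ A * (ℓ : ℤ) ^ 2) (h2 : d ∣ (ℓ : ℤ) * (B - 2 * A * j))
    (h3 : d ∣ A * j ^ 2 - B * j + C) : IsUnit d := by
  by_contra hd
  obtain ⟨q, hq, hqd⟩ := Int.exists_prime_and_dvd (mt Int.isUnit_iff_natAbs_eq.mpr hd)
  by_cases hqℓ : q ∣ (ℓ : ℤ)
  · exact hC (natCast_dvd_of_prime_dvd hℓ hq hqℓ (hqd.trans h3))
  have hqA : q ∣ A := by
    rcases hq.dvd_or_dvd (hqd.trans h1) with h | h
    · exact h
    · exact absurd (hq.dvd_of_dvd_pow h) hqℓ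
  have hqB : q ∣ B := by
    rcases hq.dvd_or_dvd (hqd.trans h2) with h | h
    · exact absurd h hqℓ
    · have h' : q ∣ B - 2 * A * j + 2 * A * j := dvd_add h (dvd_mul_of_dvd_left (hqA.mul_left 2) j)
      simpa using h'
  have hqC : q ∣ C := by
    have h' : q ∣ A * j ^ 2 - B * j + C - A * j ^ 2 + B * j :=
      dvd_add (dvd_sub (hqd.trans h3) (hqA.mul_right _)) (hqB.mul_right _)
    have : A * j ^ 2 - B * j + C - A * j ^ 2 + B * j = C := by ring
    rwa [this] at h'
  exact hq.not_unit (hprim q hqA hqB hqC)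

/-- Primitivity of `Q_∞ = (A, ℓB, ℓ²C)` for a primitive `(A, B, C)` and a prime `ℓ ∤ A`.
[folklore] -/
theorem isUnit_of_dvd_scale (hprim : ∀ d : ℤ, d ∣ A → d ∣ B → d ∣ C → IsUnit d)
    (hℓ : ℓ.Prime) (hA : ¬ ((ℓ : ℤ) ∣ A)) {d : ℤ} (h1 : d ∣ A) (h2 : d ∣ (ℓ : ℤ) * B)
    (h3 : d ∣ (ℓ : ℤ) ^ 2 * C) : IsUnit d := by
  by_contra hd
  obtain ⟨q, hq, hqd⟩ := Int.exists_prime_and_dvd (mt Int.isUnit_iff_natAbs_eq.mpr hd)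
  by_cases hqℓ : q ∣ (ℓ : ℤ)
  · exact hA (natCast_dvd_of_prime_dvd hℓ hq hqℓ (hqd.trans h1))
  have hqB : q ∣ B := by
    rcases hq.dvd_or_dvd (hqd.trans h2) with h | h
    · exact absurd h hqℓ
    · exact h
  have hqC : q ∣ C := by
    rcases hq.dvd_or_dvd (hqd.trans h3) with h | h
    · exact absurd (hq.dvd_of_dvd_pow h) hqℓ
    · exact h
  exact hq.not_unit (hprim q (hqd.trans h1) hqB hqC)

/-- The discriminant of the translate `Q_j` is `ℓ² (B² − 4AC)`. [folklore] -/
theorem disc_translate (A B C j : ℤ) (ℓ : ℕ) :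
    ((ℓ : ℤ) * (B - 2 * A * j)) ^ 2 - 4 * (A * (ℓ : ℤ) ^ 2) * (A * j ^ 2 - B * j + C) =
      (ℓ : ℤ) ^ 2 * (B ^ 2 - 4 * A * C) := by
  ring

/-- The discriminant of `Q_∞ = (A, ℓB, ℓ²C)` is `ℓ² (B² − 4AC)`. [folklore] -/
theorem disc_scale (A B C : ℤ) (ℓ : ℕ) :
    ((ℓ : ℤ) * B) ^ 2 - 4 * A * ((ℓ : ℤ) ^ 2 * C) = (ℓ : ℤ) ^ 2 * (B ^ 2 - 4 * A * C) := by
  ring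

/-- **The Hecke translate `Q_j = (A ℓ², ℓ(B − 2Aj), A j² − B j + C)` of a Heegner form
`(A, B, C) ∈ heegnerForms N D` at a prime `ℓ` inert for `D` is a Heegner form of level `N` and
discriminant `ℓ² D`** (primitive, `A ℓ² > 0`, `N ∣ A ℓ²`) — the form of the lattice
`ℤℓ + ℤ(τ_Q + j) ⊂ ℤ + ℤτ_Q` of index `ℓ`, an order-`𝒪_{ℓf}` lattice when `ℓ` is inert
(Gross 1984, §6; Gross 1991, §3, proof of Prop. 3.7). [cite: GrossLMS1991, §3 Prop. 3.7 (proof)] -/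
theorem translate_mem_heegnerForms (hQ : (A, B, C) ∈ heegnerForms N D) (hℓ : ℓ.Prime)
    (hin : ∀ x : ℤ, ¬ (4 * (ℓ : ℤ) ∣ x ^ 2 - D)) (j : ℤ) :
    (A * (ℓ : ℤ) ^ 2, (ℓ : ℤ) * (B - 2 * A * j), A * j ^ 2 - B * j + C) ∈
      heegnerForms N ((ℓ : ℤ) ^ 2 * D) := by
  simp only [heegnerForms, Set.mem_setOf_eq] at hQ ⊢
  obtain ⟨hdisc, hA, hN, hprim⟩ := hQ
  have hℓ0 : (0 : ℤ) < ℓ := by exact_mod_cast hℓ.pos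
  refine ⟨?_, mul_pos hA (pow_pos hℓ0 2), dvd_mul_of_dvd_left hN _, fun d h1 h2 h3 ↦
    isUnit_of_dvd_translate hprim hℓ (not_dvd_third_of_inert hdisc hin j) h1 h2 h3⟩
  rw [disc_translate, hdisc]

/-- **`Q_∞ = (A, ℓB, ℓ²C)` is a Heegner form of level `N` and discriminant `ℓ² D`** for
`(A, B, C) ∈ heegnerForms N D` and `ℓ` inert for `D` — the form of the index-`ℓ` lattice
`ℤ + ℤℓτ_Q` (Gross 1984, §6; Gross 1991, §3). [cite: GrossLMS1991, §3 Prop. 3.7 (proof)] -/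
theorem scale_mem_heegnerForms (hQ : (A, B, C) ∈ heegnerForms N D) (hℓ : ℓ.Prime)
    (hin : ∀ x : ℤ, ¬ (4 * (ℓ : ℤ) ∣ x ^ 2 - D)) :
    (A, (ℓ : ℤ) * B, (ℓ : ℤ) ^ 2 * C) ∈ heegnerForms N ((ℓ : ℤ) ^ 2 * D) := by
  simp only [heegnerForms, Set.mem_setOf_eq] at hQ ⊢
  obtain ⟨hdisc, hA, hN, hprim⟩ := hQ
  refine ⟨?_, hA, hN, fun d h1 h2 h3 ↦
    isUnit_of_dvd_scale hprim hℓ (not_dvd_fst_of_inert hdisc hin) h1 h2 h3⟩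
  rw [disc_scale, hdisc]

/-- The middle coefficient of `Q_j` is `≡ ℓ B (mod 2N)` (`N ∣ A`): the translates keep the
orientation class `β ↦ ℓβ` of `HeegnerDatum`. [folklore] -/
theorem translate_snd_modEq (hN : (N : ℤ) ∣ A) (ℓ : ℕ) (j : ℤ) :
    (ℓ : ℤ) * (B - 2 * A * j) ≡ (ℓ : ℤ) * B [ZMOD 2 * N] := by
  obtain ⟨a, rfl⟩ := hN
  exact Int.modEq_iff_dvd.mpr ⟨ℓ * a * j, by ring⟩

/-! ### Their Heegner points are the `T_ℓ`-neighbours `(τ_Q + j)/ℓ`, `ℓ τ_Q` -/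

/-- **`τ_{Q_j} = (τ_Q + j)/ℓ = tpB ℓ j • τ_Q`**: the point `(τ_Q + j)/ℓ` is a root of
`A ℓ² X² + ℓ(B − 2Aj) X + (A j² − B j + C)` (substitute `τ_Q = ℓ X − j` in `A τ² + B τ + C = 0`)
in `ℍ`, hence the Heegner point of `Q_j` (Diamond–Shurman (5.2), `β_j = (1 j; 0 ℓ)`).
[cite: DiamondShurman2005, (5.2)] -/
theorem heegnerTau_translate [NeZero ℓ] (hA : 0 < A) (hD : B ^ 2 - 4 * A * C < 0) (j : ℤ) :
    heegnerTau (A * (ℓ : ℤ) ^ 2, (ℓ : ℤ) * (B - 2 * A * j), A * j ^ 2 - B * j + C) =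
      tpB ℓ j • heegnerTau (A, B, C) := by
  have hℓ0 : (0 : ℤ) < ℓ := by exact_mod_cast Nat.pos_of_ne_zero (NeZero.ne ℓ)
  have hA' : 0 < A * (ℓ : ℤ) ^ 2 := mul_pos hA (pow_pos hℓ0 2)
  have hD' : ((ℓ : ℤ) * (B - 2 * A * j)) ^ 2 - 4 * (A * (ℓ : ℤ) ^ 2) * (A * j ^ 2 - B * j + C)
      < 0 := by
    rw [disc_translate]
    exact mul_neg_of_pos_of_neg (pow_pos hℓ0 2) hD
  symm
  refine eq_heegnerTau_of_isRoot (Q := (_, _, _)) hA' hD' _ ?_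
  have hroot := heegnerTau_isRoot (Q := (A, B, C)) hA hD
  dsimp only at hroot ⊢
  set τ : ℂ := (heegnerTau (A, B, C) : ℂ) with hτ
  set z : ℂ := ((tpB ℓ j • heegnerTau (A, B, C) : ℍ) : ℂ) with hz
  have hℓC : (ℓ : ℂ) ≠ 0 := by exact_mod_cast NeZero.ne ℓ
  have hz' : (ℓ : ℂ) * z = τ + j := by
    rw [hz, coe_tpB_smul, ← hτ]
    field_simp
  push_cast
  linear_combination hroot + ((A : ℂ) * ((ℓ : ℂ) * z + τ + j) + B - 2 * A * j) * hz'

/-- **`τ_{Q_∞} = ℓ τ_Q = tpD ℓ • τ_Q`**: `ℓ τ_Q` is a root of `A X² + ℓB X + ℓ²C` in `ℍ`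
(Diamond–Shurman (5.2), `β_∞ ≡ (ℓ 0; 0 1) mod Γ₀(N)`). [cite: DiamondShurman2005, (5.2)] -/
theorem heegnerTau_scale [NeZero ℓ] (hA : 0 < A) (hD : B ^ 2 - 4 * A * C < 0) :
    heegnerTau (A, (ℓ : ℤ) * B, (ℓ : ℤ) ^ 2 * C) = tpD ℓ • heegnerTau (A, B, C) := by
  have hℓ0 : (0 : ℤ) < ℓ := by exact_mod_cast Nat.pos_of_ne_zero (NeZero.ne ℓ)
  have hD' : ((ℓ : ℤ) * B) ^ 2 - 4 * A * ((ℓ : ℤ) ^ 2 * C) < 0 := by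
    rw [disc_scale]
    exact mul_neg_of_pos_of_neg (pow_pos hℓ0 2) hD
  symm
  refine eq_heegnerTau_of_isRoot (Q := (_, _, _)) hA hD' _ ?_
  have hroot := heegnerTau_isRoot (Q := (A, B, C)) hA hD
  dsimp only at hroot ⊢
  rw [coe_tpD_smul]
  push_cast
  linear_combination ((ℓ : ℂ)) ^ 2 * hroot

/-- `τ_{Q_j} = (τ_Q + j)/ℓ` as complex numbers. [cite: DiamondShurman2005, (5.2)] -/
theorem coe_heegnerTau_translate [NeZero ℓ] (hA : 0 < A) (hD : B ^ 2 - 4 * A * C < 0) (j : ℤ) :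
    ((heegnerTau (A * (ℓ : ℤ) ^ 2, (ℓ : ℤ) * (B - 2 * A * j), A * j ^ 2 - B * j + C) : ℍ) : ℂ) =
      ((heegnerTau (A, B, C) : ℂ) + j) / ℓ := by
  rw [heegnerTau_translate hA hD j, coe_tpB_smul]

/-- `τ_{Q_∞} = ℓ τ_Q` as complex numbers. [cite: DiamondShurman2005, (5.2)] -/
theorem coe_heegnerTau_scale [NeZero ℓ] (hA : 0 < A) (hD : B ^ 2 - 4 * A * C < 0) :
    ((heegnerTau (A, (ℓ : ℤ) * B, (ℓ : ℤ) ^ 2 * C) : ℍ) : ℂ) = ℓ * (heegnerTau (A, B, C) : ℂ) := by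
  rw [heegnerTau_scale hA hD, coe_tpD_smul]

/-! ### Gross's form of conductor `mℓ` is the neighbour `Q_0` of the form of conductor `m` -/

/-- **`heegnerFormOfConductor D β (mℓ)` is the `j = 0` Hecke translate of
`heegnerFormOfConductor D β m`**: `((mℓ)²c, mℓβ, 1) = (A ℓ², ℓ B, C)` for
`(A, B, C) = (m²c, mβ, 1)`, `c = (β² − D)/4` (Gross 1991, §3: `x_n`, `n = ℓm`, lies in
`T_ℓ(x_m)`). [cite: GrossLMS1991, §3 Prop. 3.7 (proof)] -/
theorem heegnerFormOfConductor_mul (D β : ℤ) (m ℓ : ℕ) :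
    heegnerFormOfConductor D β (m * ℓ) =
      ((heegnerFormOfConductor D β m).1 * (ℓ : ℤ) ^ 2, (ℓ : ℤ) * (heegnerFormOfConductor D β m).2.1,
        (heegnerFormOfConductor D β m).2.2) := by
  simp only [heegnerFormOfConductor, Nat.cast_mul, Prod.mk.injEq]
  exact ⟨by ring, by ring, trivial⟩

/-- `A > 0` and `B² − 4AC (= m²D) < 0` for Gross's form of conductor `m ≠ 0` (`D < 0`,
`4 ∣ β² − D`; the tree's `heegnerFormOfConductor_mem_heegnerForms` at level `1`). [folklore] -/
theorem heegnerFormOfConductor_pos_neg {D β : ℤ} (hD : D < 0) (h4 : (4 : ℤ) ∣ β ^ 2 - D)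
    {m : ℕ} (hm : m ≠ 0) :
    0 < (heegnerFormOfConductor D β m).1 ∧
      (heegnerFormOfConductor D β m).2.1 ^ 2 -
        4 * (heegnerFormOfConductor D β m).1 * (heegnerFormOfConductor D β m).2.2 < 0 := by
  obtain ⟨hdisc, hA, -, -⟩ :=
    (heegnerFormOfConductor_mem_heegnerForms (N := 1) hD (by simpa using h4) hm).1
  refine ⟨hA, ?_⟩
  rw [hdisc]
  exact mul_neg_of_pos_of_neg (pow_pos (by exact_mod_cast Nat.pos_of_ne_zero hm) 2) hD

/-- **`x(mℓ) = tpB ℓ 0 • x(m) = x(m)/ℓ`** (`D < 0`, `4 ∣ β² − D`, `m ≠ 0`): Gross's Heegner point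
of conductor `mℓ` is the `j = 0` Hecke neighbour of the point of conductor `m` (the tree's
`coe_heegnerPointOfConductor_eq_div`, in `T_ℓ`-form). [cite: GrossLMS1991, §3 Prop. 3.7 (proof)] -/
theorem heegnerPointOfConductor_mul [NeZero ℓ] {D β : ℤ} (hD : D < 0) (h4 : (4 : ℤ) ∣ β ^ 2 - D)
    {m : ℕ} (hm : m ≠ 0) :
    heegnerPointOfConductor D β (m * ℓ) = tpB ℓ 0 • heegnerPointOfConductor D β m := by
  obtain ⟨hA, hQ⟩ := heegnerFormOfConductor_pos_neg hD h4 hm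
  rw [heegnerPointOfConductor, heegnerPointOfConductor, heegnerFormOfConductor_mul]
  convert heegnerTau_translate hA hQ 0 using 3
  simp

/-! ### Corollary: `a_ℓ • φ(τ_Q) = Σ_{T_ℓ-neighbours} φ(τ_{Q_j})` in `E(ℂ)` -/

/-- **`a_ℓ(W) • φ(τ_Q) = Σ_{j mod ℓ} φ(τ_{Q_j}) + φ(τ_{Q_∞})` in `E(ℂ)`** for a modular
parametrisation datum `Dt` of `W/ℚ` at level `N`, a prime `ℓ ∤ N` and a positive definite form
`Q = (A, B, C)`: the tree's Hecke equivariance `φ ∘ T_ℓ = [a_ℓ] ∘ φ`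
(`ModularParametrizationData.lFunction_zsmul_φ_of_not_dvd`, Knapp Thm. 11.74 (b)) with the
`T_ℓ`-neighbours of `τ_Q` identified as Heegner points (`heegnerTau_translate`, `heegnerTau_scale`).
This is "`φ(T_ℓ d) = a_ℓ · φ(d)`" of Gross's proof of Prop. 3.7 (1) at `d = (x)`, `x = τ_Q`.
[cite: GrossLMS1991, §3 Prop. 3.7 (proof)] -/
theorem lFunction_smul_φ_heegnerTau [NeZero N] {W : WeierstrassCurve ℚ}
    (Dt : ModularParametrizationData W N) (hℓ : ℓ.Prime) (hℓN : ¬ ℓ ∣ N) (hA : 0 < A)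
    (hD : B ^ 2 - 4 * A * C < 0) :
    W.LFunction ℓ • Dt.φ (heegnerTau (A, B, C)) =
      ∑ j : Fin ℓ, Dt.φ (heegnerTau
          (A * (ℓ : ℤ) ^ 2, (ℓ : ℤ) * (B - 2 * A * ((j : ℕ) : ℤ)),
            A * ((j : ℕ) : ℤ) ^ 2 - B * ((j : ℕ) : ℤ) + C)) +
        Dt.φ (heegnerTau (A, (ℓ : ℤ) * B, (ℓ : ℤ) ^ 2 * C)) := by
  haveI : NeZero ℓ := ⟨hℓ.ne_zero⟩
  rw [Dt.lFunction_zsmul_φ_of_not_dvd ℓ hℓ hℓN]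
  simp only [heegnerTau_translate hA hD, heegnerTau_scale hA hD]

/-- The `j = 0` term: **`y(mℓ) = φ(tpB ℓ 0 • x(m)) = φ(x(m)/ℓ)`** (`D < 0`, `4 ∣ β² − D`,
`m ≠ 0`). [cite: GrossLMS1991, §3 Prop. 3.7 (proof)] -/
theorem heegnerPointComplexOfConductor_mul [NeZero N] [NeZero ℓ] {W : WeierstrassCurve ℚ}
    (Dt : ModularParametrizationData W N) {D β : ℤ} (hD : D < 0) (h4 : (4 : ℤ) ∣ β ^ 2 - D)
    {m : ℕ} (hm : m ≠ 0) :
    heegnerPointComplexOfConductor Dt D β (m * ℓ) =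
      Dt.φ (tpB ℓ 0 • heegnerPointOfConductor D β m) := by
  rw [heegnerPointComplexOfConductor, heegnerPointOfConductor_mul hD h4 hm]

/-- **`a_ℓ(W) • y(m) = Σ_{j mod ℓ} φ(τ_{Q_j}) + φ(τ_{Q_∞})`**, `Q = heegnerFormOfConductor D β m`
(`D < 0`, `4 ∣ β² − D`, `m ≠ 0`, `ℓ ∤ N` prime), where the `j = 0` term is `y(mℓ)`
(`heegnerPointComplexOfConductor_mul`, `heegnerFormOfConductor_mul`): the `φ`-image identity behind
Gross's `a_ℓ y_m = φ(T_ℓ x_m)` (Prop. 3.7 (1), proof). What it does NOT say: that the other `ℓ`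
terms are the `Gal(K[mℓ]/K[m])`-conjugates of `y(mℓ)` (Shimura reciprocity — not in this file).
[cite: GrossLMS1991, §3 Prop. 3.7 (proof)] -/
theorem lFunction_smul_heegnerPointComplexOfConductor [NeZero N] {W : WeierstrassCurve ℚ}
    (Dt : ModularParametrizationData W N) (hℓ : ℓ.Prime) (hℓN : ¬ ℓ ∣ N) {D β : ℤ} (hD : D < 0)
    (h4 : (4 : ℤ) ∣ β ^ 2 - D) {m : ℕ} (hm : m ≠ 0) :
    W.LFunction ℓ • heegnerPointComplexOfConductor Dt D β m =
      ∑ j : Fin ℓ, Dt.φ (heegnerTau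
          ((heegnerFormOfConductor D β m).1 * (ℓ : ℤ) ^ 2,
            (ℓ : ℤ) * ((heegnerFormOfConductor D β m).2.1 -
              2 * (heegnerFormOfConductor D β m).1 * ((j : ℕ) : ℤ)),
            (heegnerFormOfConductor D β m).1 * ((j : ℕ) : ℤ) ^ 2 -
              (heegnerFormOfConductor D β m).2.1 * ((j : ℕ) : ℤ) +
              (heegnerFormOfConductor D β m).2.2)) +
        Dt.φ (heegnerTau ((heegnerFormOfConductor D β m).1,
          (ℓ : ℤ) * (heegnerFormOfConductor D β m).2.1,
          (ℓ : ℤ) ^ 2 * (heegnerFormOfConductor D β m).2.2)) := by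
  obtain ⟨hA, hQ⟩ := heegnerFormOfConductor_pos_neg hD h4 hm
  exact lFunction_smul_φ_heegnerTau Dt hℓ hℓN hA hQ

end Summit.BirchSwinnertonDyer.Rank1Residual.X11b.HeegnerHecke
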